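import Summits.QuantumFields.YangMills.Theorems.BalabanUVNodesN15BackgroundByPartsSlim
import Summits.QuantumFields.YangMills.Theorems.BalabanUVNodesN15BackgroundCoefficientTaylor
import HarnessLib

/-!
# `NE2PlusOperator` BY NAME FOR THE FULL PROPAGATOR OVER THE PRIMITIVE (3.35)–(3.36) CARRIER: sup letters on the coefficient family, its first and its second
# difference quotients — EVERY two-grid fit clause DERIVED (dag-n15-c g8, FILE 11; Track-A node N15 = NE2, s1 «background-layer OPERATOR ingredient»)

`--kind proof --supports stmt-QuantumFields-20544 --as helper` (K3⁷; count-neutral).  Imports BY NAME this seat's FILE 9 `…N15BackgroundByPartsSlim` (`coeffBgSlim`,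
`fgInstanceSlim`, `fgFamilySlim`, `ne2PlusOperator_fullG_slim`, `inv_pow_le_rate`) and FILE 10 `…N15BackgroundCoefficientTaylor` (`fibreOsc_of_fgrad`,
`abs_fgrad_blockAvg_le`, `abs_derivFit_le'`).

WHAT.  §1 the PRIMITIVE carrier `coeffBgC2 J τ′ n′ M`: a first-order coefficient family `U = (c′, a′_μ)` on ONE lattice is regular at level `c` iff
`|c′|, |a′_μ| ≤ cMα₀` (values), `|∇′_κc′|, |∇′_κa′_μ| ≤ cMα₀` (all first difference quotients) — the (3.35) letters — and `|∇′_κ∇′_μa′_μ| ≤ cMα₀` (the second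
quotients the by-parts device differentiates) — the (3.36) letter; NO block map, NO coarse partner, NO rate number in the predicate.  Pairing ∕ instance ∕ kernel
family over it (same entry operators `bgOpsBP`; coarse slot = the same primitive carrier on the coarse lattice).  §2 the torus instance `fgInstanceC2 d hL i` ∕
`fgFamilyC2 d hL b i` — NO rate exponent among the data.  §3 ★ `reg_slim_of_C2`: on the torus family of record, primitive-regular at level `c` ⟹ slim-regular (FILE 9)
at level `(2d+3)c` with rate number `θ = (L^k)^{−γ}`, ANY `γ ≤ 1` (FILE 10: block oscillation `≤ 2(d+1)cMα₀∕L^k`, coarse gradient of the mean `≤ cMα₀`, derivative fit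
`≤ (2d+3)cMα₀∕L^k`, and `L^{−k} ≤ θ`); ★★ transfer `ne2PlusOperator_fullG_C2_of_slim`; ★★★ `ne2PlusOperator_fullG_C2`:
`NE2PlusOperator c₃₅ (fgInstanceC2 d hL) (fgFamilyC2 d hL b)` — `d ≥ 1`, odd `L ≥ 3`, `b > 0`, `c₃₅ > 0` — HYPOTHESIS-FREE, the rate exponent PRODUCED (`1∕(8(d+1))`,
inside the `∃`), not supplied.

HONEST FRAMING.  The background species is still MODEL-LEVEL in two respects only: abelianised first-order coefficients (`V′₁` of (3.52) as scalar multiplications,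
both orientations collapsed to the forward one) and the block-averaged coarse partner (convention (C3)); its REGULARITY hypotheses are now exactly sup letters on
`U`, `∇′U`, `∇′∇′U` — the shape of (3.35)–(3.36) (crudely: one uniform constant `cMα₀`, no scale-dependent gains).  GENUINE in the propagator.  NE2⁺ as printed
(non-abelian `V′(A)`) NOT PRINTED; N15 not discharged; nothing continuum ∕ OS ∕ mass-gap ∕ Clay.
-/

noncomputable section

open scoped BigOperators
open Finset

namespace Summit.QuantumFields.YangMills.BalabanUVNodes.N15.BackgroundLayer

open Literature.MathematicalPhysics.QuantumFieldTheory.Balaban1983to89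
open Literature.MathematicalPhysics.QuantumFieldTheory.Balaban1983to89.T4EtaRate (PairedInstance EtaPairing EtaRateIneq342 NE2PlusOperator)
open Literature.MathematicalPhysics.QuantumFieldTheory.Balaban1983to89.T4EtaRateCoeffDefect (pull FibreOsc blockAvg fit_blockAvg)
open Literature.MathematicalPhysics.QuantumFieldTheory.Balaban1983to89.B5Prop11Plancherel (Tor fine unitVec)
open Literature.MathematicalPhysics.QuantumFieldTheory.Balaban1983to89.B5SiteBridgeP12 (MP)
open Literature.MathematicalPhysics.QuantumFieldTheory.Balaban1983to89.B6UnitTorusCarrier (unitTorusGeo)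
open Summit.QuantumFields.YangMills.BalabanUVNodes.N15.OperatorReadout (opGeo opFamily)
open Summit.QuantumFields.YangMills.BalabanUVNodes.N15.TwoGrid (gOp symbOp sLap TGIndex TGIndex.Mn)
open Summit.QuantumFields.YangMills.BalabanUVNodes.N15.VectorPiece (blkFine kingPrV bshiftEquiv bshiftEquiv_apply bshiftEquiv_symm_apply)

variable {d : ℕ}

/-! ## §1 The primitive carrier, its pairing, instance and kernel family -/

section Carrier

variable {X X' : Type} (J : Type) [Fintype X'] [DecidableEq X]

/-- THE PRIMITIVE (3.35)–(3.36)-SHAPED CARRIER of a first-order coefficient family `U = (c′, a′_μ)` on one lattice with bond shifts `τ′_κ` and quotient parameter `n′`: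
level-`c` regularity = `|c′|, |a′_μ| ≤ cMα₀`, `|∇′_κc′|, |∇′_κa′_μ| ≤ cMα₀` (the (3.35) letters: field and first quotients, all directions) and `|∇′_κ∇′_μa′_μ| ≤ cMα₀`
(the (3.36) letter: second quotients); the (3.36) slot alone carries the second-quotient letter; no complexification clauses.
[cite: Balaban1985BackgroundPropagators, (3.35)–(3.36) p.396 (shape)] -/
def coeffBgC2 (τ' : J → X' ≃ X') (n' M : ℝ) : B9.Backgrounds where
  Cfg := (X' → ℝ) × (J → X' → ℝ)
  one := 0
  mul := fun U₁ U₂ => U₁ + U₂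
  Reg335 := fun c α₀ U =>
    ((∀ x', |U.1 x'| ≤ c * M * α₀) ∧ ∀ μ x', |U.2 μ x'| ≤ c * M * α₀) ∧
      ((∀ κ x', |fgrad n' (τ' κ) U.1 x'| ≤ c * M * α₀) ∧ ∀ μ κ x', |fgrad n' (τ' κ) (U.2 μ) x'| ≤ c * M * α₀) ∧
        ∀ μ κ x', |fgrad n' (τ' κ) (fgrad n' (τ' μ) (U.2 μ)) x'| ≤ c * M * α₀
  Reg336 := fun c α₀ U => ∀ μ κ x', |fgrad n' (τ' κ) (fgrad n' (τ' μ) (U.2 μ)) x'| ≤ c * M * α₀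
  Cplx337 := fun _ _ _ => True
  Cplx338 := fun _ _ _ => True

variable {g : B6.Geometry} [Fintype X]

/-- THE η-PAIRING over the primitive carriers (fine: `coeffBgC2` at `n′`; coarse: `coeffBgC2` at `n` on the coarse lattice) — NOT PRINTED data, as FILE 7a's `bgPairingBP`.
[cite: King1986, p.664 (convention before Prop. 3.8)] -/
def bgPairingC2 (blk : X → g.Site) (π : X' → X) (τ : J → X ≃ X) (τ' : J → X' ≃ X') (n n' : ℝ) (m : ℕ) (hL : g.L ≠ 0) :
    EtaPairing (opGeo g X blk) (fineGeo g X' (blk ∘ π) m) (coeffBgC2 J τ n g.M) (coeffBgC2 J τ' n' g.M) where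
  n := m
  k_eq := rfl
  L_eq := rfl
  M_eq := rfl
  eta_eq := (bgPairingBP J blk π τ τ' n n' m hL 0 0).eta_eq
  ι := fun y => y
  scale_ι := fun _ => rfl
  dist_ι := fun _ _ => rfl
  τ := fun lam => pull π lam
  suppIn_τ := fun _ _ h x' hx' => h (π x') hx'
  supNorm_τ := (bgPairingBP J blk π τ τ' n n' m hL 0 0).supNorm_τ
  avg := avg₁ J π
  avg_one := avg₁_zero J π

/-- THE REALISED PAIRED INSTANCE of the by-parts layer over the PRIMITIVE carriers. [cite: Balaban1985BackgroundPropagators, Thm 3.14 pp.426–427 (typing template)] -/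
def bgInstanceC2 (blk : X → g.Site) (π : X' → X) (τ : J → X ≃ X) (τ' : J → X' ≃ X') (n n' : ℝ) (m : ℕ) (hL : g.L ≠ 0) : PairedInstance :=
  ⟨opGeo g X blk, fineGeo g X' (blk ∘ π) m, coeffBgC2 J τ n g.M, coeffBgC2 J τ' n' g.M, bgPairingC2 J blk π τ τ' n n' m hL⟩

/-- THE GUARD IS LIVE: the fine geometry's size parameter is the datum's `M`. [folklore] -/
theorem bgInstanceC2_M (blk : X → g.Site) (π : X' → X) (τ : J → X ≃ X) (τ' : J → X' ≃ X') (n n' : ℝ) (m : ℕ) (hL : g.L ≠ 0) :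
    (bgInstanceC2 J blk π τ τ' n n' m hL).gf.M = g.M := rfl

end Carrier

section Ops

variable {X X' J : Type} [Fintype X] [Fintype X'] [Fintype J] [DecidableEq X] [DecidableEq X'] [DecidableEq J] {g : B6.Geometry}
  (blk : X → g.Site) (π : X' → X)

/-- THE KERNEL FAMILY over the primitive carrier: FILE 7a's four entry operators (entry 2 by parts) read through the block norms. [cite: Balaban1985BackgroundPropagators, (3.42) p.397 (shape)] -/
def bgFamilyC2 (τ : J → X ≃ X) (τ' : J → X' ≃ X') (n n' : ℝ) (m : ℕ) (hL : g.L ≠ 0) (ν : J) (G D₃ : (X → ℝ) →ₗ[ℝ] (X → ℝ))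
    (D : J → (X → ℝ) →ₗ[ℝ] (X → ℝ)) (G' D₃' : (X' → ℝ) →ₗ[ℝ] (X' → ℝ)) (D' : J → (X' → ℝ) →ₗ[ℝ] (X' → ℝ)) :
    B9.KernelFamily (bgInstanceC2 J blk π τ τ' n n' m hL).gc (bgInstanceC2 J blk π τ τ' n n' m hL).Bf :=
  show B9.KernelFamily (opGeo g X blk) (coeffBgC2 J τ' n' g.M) from
    opFamily (g := g) (B := coeffBgC2 J τ' n' g.M) blk (blk ∘ π) (bgOpsBP π τ τ' n n' ν G D₃ D G' D₃' D')

/-- THE RATE INEQUALITY IS THE SAME PREDICATE over the primitive and the slim carriers (same geometry, same entry operators). [folklore] -/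
theorem etaRateIneq342_C2_iff (τ : J → X ≃ X) (τ' : J → X' ≃ X') (n n' : ℝ) (m : ℕ) (hL : g.L ≠ 0) (θc θ : ℝ) (ν : J)
    (G D₃ : (X → ℝ) →ₗ[ℝ] (X → ℝ)) (D : J → (X → ℝ) →ₗ[ℝ] (X → ℝ)) (G' D₃' : (X' → ℝ) →ₗ[ℝ] (X' → ℝ)) (D' : J → (X' → ℝ) →ₗ[ℝ] (X' → ℝ))
    (B₀ δ₀ γ : ℝ) (U : (X' → ℝ) × (J → X' → ℝ)) :
    EtaRateIneq342 (bgFamilyC2 blk π τ τ' n n' m hL ν G D₃ D G' D₃' D') B₀ δ₀ γ U ↔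
      EtaRateIneq342 (bgFamilySlim blk π τ τ' n n' m hL θc θ ν G D₃ D G' D₃' D') B₀ δ₀ γ U :=
  Iff.rfl

end Ops

/-! ## §2 The torus instance over the primitive carrier — no rate exponent among the data -/

section Torus

variable {L : ℕ} [NeZero L]

variable (d)

/-- THE REALISED PAIRED INSTANCE at an index `(i, ν)` of the torus family of record over the PRIMITIVE carriers (King's pairing, bond shifts `bshiftEquiv` at spacings
`L^{−k}` ∕ `L^{−m−k}`, quotient parameters `L^k` ∕ `L^mL^k`); NO rate number. [cite: Balaban1985BackgroundPropagators, Thm 3.14 pp.426–427 (typing template)] -/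
def fgInstanceC2 (hL : Odd L ∧ 1 < L) (i : TGIndex × Fin (d + 1)) : PairedInstance :=
  bgInstanceC2 (Fin (d + 1)) (g := unitTorusGeo L i.1.k (TGIndex.Mn d hL i.1)) (blkFine L i.1.k (TGIndex.Mn d hL i.1)) (kingPrV L i.1.k i.1.m (TGIndex.Mn d hL i.1))
    (fun μ => bshiftEquiv (TGIndex.Mn d hL i.1) (L ^ i.1.k) μ) (fun μ => bshiftEquiv (TGIndex.Mn d hL i.1) (L ^ i.1.m * L ^ i.1.k) μ) ((L ^ i.1.k : ℕ) : ℝ)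
    ((L ^ i.1.m * L ^ i.1.k : ℕ) : ℝ) i.1.m (Nat.cast_ne_zero.mpr (NeZero.ne L))

/-- THE REALISED BY-PARTS KERNEL FAMILY at `(i, ν)` over the primitive carrier (FILE 8's operators: `G = gOp`, `D_μ = ∇_μG`, `D₃ = ΔG` at both spacings).
[cite: Balaban1985BackgroundPropagators, (3.42) p.397 (shape)] -/
def fgFamilyC2 (hL : Odd L ∧ 1 < L) (b : ℝ) (i : TGIndex × Fin (d + 1)) : B9.KernelFamily (fgInstanceC2 d hL i).gc (fgInstanceC2 d hL i).Bf :=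
  bgFamilyC2 (J := Fin (d + 1)) (g := unitTorusGeo L i.1.k (TGIndex.Mn d hL i.1)) (blkFine L i.1.k (TGIndex.Mn d hL i.1)) (kingPrV L i.1.k i.1.m (TGIndex.Mn d hL i.1))
    (fun μ => bshiftEquiv (TGIndex.Mn d hL i.1) (L ^ i.1.k) μ) (fun μ => bshiftEquiv (TGIndex.Mn d hL i.1) (L ^ i.1.m * L ^ i.1.k) μ) ((L ^ i.1.k : ℕ) : ℝ)
    ((L ^ i.1.m * L ^ i.1.k : ℕ) : ℝ) i.1.m (Nat.cast_ne_zero.mpr (NeZero.ne L)) i.2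
    (gOp (TGIndex.Mn d hL i.1) (L ^ i.1.k) b)
    (symbOp (TGIndex.Mn d hL i.1) (L ^ i.1.k) (sLap (TGIndex.Mn d hL i.1) (L ^ i.1.k) ((L ^ i.1.k : ℕ) : ℝ)) ∘ₗ gOp (TGIndex.Mn d hL i.1) (L ^ i.1.k) b)
    (fgD d (TGIndex.Mn d hL i.1) (L ^ i.1.k) b)
    (gOp (TGIndex.Mn d hL i.1) (L ^ i.1.m * L ^ i.1.k) b)
    (symbOp (TGIndex.Mn d hL i.1) (L ^ i.1.m * L ^ i.1.k) (sLap (TGIndex.Mn d hL i.1) (L ^ i.1.m * L ^ i.1.k) ((L ^ i.1.m * L ^ i.1.k : ℕ) : ℝ)) ∘ₗ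
      gOp (TGIndex.Mn d hL i.1) (L ^ i.1.m * L ^ i.1.k) b)
    (fgD d (TGIndex.Mn d hL i.1) (L ^ i.1.m * L ^ i.1.k) b)

end Torus

/-! ## §3 Primitive ⟹ slim on the torus; the transfer; ★★★ the node theorem over the primitive carrier -/

section Transfer

variable {L : ℕ} [NeZero L]

/-- ★ **PRIMITIVE ⟹ SLIM AT LEVEL `(2d+3)c`** on the torus family of record, for ANY rate exponent `γ ≤ 1` (`θ = (L^k)^{−γ} ≥ L^{−k}`): the block oscillations
(`fibreOsc_of_fgrad`: `≤ 2(d+1)cMα₀∕L^k`), the coarse gradient of the block mean (`abs_fgrad_blockAvg_le`: `≤ cMα₀`) and the derivative fit (`abs_derivFit_le'`: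
`≤ (2d+3)cMα₀∕L^k`) are CONSEQUENCES of the primitive letters. [folklore] -/
theorem reg_slim_of_C2 (hL : Odd L ∧ 1 < L) {γ : ℝ} (hγ1 : γ ≤ 1) {c α₀ : ℝ} (i : TGIndex × Fin (d + 1))
    (hc : 0 ≤ c * (unitTorusGeo L i.1.k (TGIndex.Mn d hL i.1)).M * α₀) (U : (fgInstanceC2 d hL i).Bf.Cfg) (hU : (fgInstanceC2 d hL i).Bf.Reg335 c α₀ U) :
    (fgInstanceSlim d hL γ i).Bf.Reg335 ((2 * (d : ℝ) + 3) * c) α₀ U := by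
  obtain ⟨⟨hA, hB⟩, ⟨hC1, hC2⟩, hQ⟩ := hU
  have hL0 : 0 < L := by have := hL.2; omega
  have hL1 : (1 : ℝ) ≤ (L : ℝ) := by exact_mod_cast hL.2.le
  have hnf : (0 : ℝ) < ((L ^ i.1.m * L ^ i.1.k : ℕ) : ℝ) := by positivity
  have hnc : (0 : ℝ) < ((L ^ i.1.k : ℕ) : ℝ) := by positivity
  set A := c * (unitTorusGeo L i.1.k (TGIndex.Mn d hL i.1)).M * α₀ with hAdef
  have hd0 : (0 : ℝ) ≤ d := Nat.cast_nonneg d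
  have hθ : (((L ^ i.1.k : ℕ) : ℝ))⁻¹ ≤ ((L : ℝ) ^ i.1.k) ^ (-γ) := inv_pow_le_rate hL1 hγ1
  have hθ0 : 0 ≤ ((L : ℝ) ^ i.1.k) ^ (-γ) := Real.rpow_nonneg (pow_nonneg (by positivity) _) _
  -- level bookkeeping
  have hlev : A ≤ (2 * (d : ℝ) + 3) * c * (unitTorusGeo L i.1.k (TGIndex.Mn d hL i.1)).M * α₀ := by
    have : (2 * (d : ℝ) + 3) * c * (unitTorusGeo L i.1.k (TGIndex.Mn d hL i.1)).M * α₀ = (2 * (d : ℝ) + 3) * A := by rw [hAdef]; ring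
    rw [this]; nlinarith
  have hlevθ : ∀ {t : ℝ}, t ≤ (2 * (d : ℝ) + 3) * A / ((L ^ i.1.k : ℕ) : ℝ) →
      t ≤ (2 * (d : ℝ) + 3) * c * (unitTorusGeo L i.1.k (TGIndex.Mn d hL i.1)).M * α₀ * ((L : ℝ) ^ i.1.k) ^ (-γ) := fun {t} ht => by
    refine ht.trans ?_
    rw [div_eq_mul_inv, show (2 * (d : ℝ) + 3) * c * (unitTorusGeo L i.1.k (TGIndex.Mn d hL i.1)).M * α₀ = (2 * (d : ℝ) + 3) * A by rw [hAdef]; ring]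
    exact mul_le_mul_of_nonneg_left hθ (by positivity)
  -- block oscillation constant
  have hoscK : (((2 * ((d + 1) * (L ^ i.1.m - 1)) : ℕ) : ℝ)) * (A / ((L ^ i.1.m * L ^ i.1.k : ℕ) : ℝ)) ≤ (2 * (d : ℝ) + 3) * A / ((L ^ i.1.k : ℕ) : ℝ) := by
    have h1 : ((L ^ i.1.m - 1 : ℕ) : ℝ) ≤ ((L ^ i.1.m : ℕ) : ℝ) := by exact_mod_cast Nat.sub_le _ _
    have hsub : (((2 * ((d + 1) * (L ^ i.1.m - 1)) : ℕ) : ℝ)) ≤ (2 * (d : ℝ) + 3) * ((L ^ i.1.m : ℕ) : ℝ) := by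
      push_cast at h1 ⊢
      have hLm : (0 : ℝ) ≤ (L : ℝ) ^ i.1.m := by positivity
      nlinarith
    have hnfc : ((L ^ i.1.m * L ^ i.1.k : ℕ) : ℝ) = ((L ^ i.1.m : ℕ) : ℝ) * ((L ^ i.1.k : ℕ) : ℝ) := by push_cast; ring
    calc (((2 * ((d + 1) * (L ^ i.1.m - 1)) : ℕ) : ℝ)) * (A / ((L ^ i.1.m * L ^ i.1.k : ℕ) : ℝ))
        ≤ (2 * (d : ℝ) + 3) * ((L ^ i.1.m : ℕ) : ℝ) * (A / ((L ^ i.1.m * L ^ i.1.k : ℕ) : ℝ)) := mul_le_mul_of_nonneg_right hsub (by positivity)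
      _ = (2 * (d : ℝ) + 3) * A / ((L ^ i.1.k : ℕ) : ℝ) := by rw [hnfc]; field_simp
  refine ⟨⟨⟨fun x' => (hA x').trans hlev, fun μ x' => (hB μ x').trans hlev⟩, ?_, fun μ => ?_⟩, fun μ x => ?_, fun μ x' => (hC2 μ μ x').trans hlev, fun μ x' => ?_⟩
  · exact (fibreOsc_of_fgrad L i.1.k i.1.m (TGIndex.Mn d hL i.1) hnf hC1).mono fun _ => hlevθ hoscK
  · exact (fibreOsc_of_fgrad L i.1.k i.1.m (TGIndex.Mn d hL i.1) hnf (hC2 μ)).mono fun _ => hlevθ hoscK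
  · exact (abs_fgrad_blockAvg_le L i.1.k i.1.m (TGIndex.Mn d hL i.1) (hc) μ (hC2 μ μ) x).trans hlev
  · refine hlevθ ((abs_derivFit_le' L i.1.k i.1.m (TGIndex.Mn d hL i.1) hc μ (hQ μ) x').trans (le_of_eq ?_))
    ring

variable (d)

/-- ★★ **TRANSFER**: `NE2PlusOperator ((2d+3)c₃₅)` for FILE 9's family over the slim carrier (rate exponent `γ ≤ 1`) gives `NE2PlusOperator c₃₅` over the PRIMITIVE
carrier — same predicate, larger admitted class (`reg_slim_of_C2`). [cite: Balaban1985BackgroundPropagators, Thm 3.1 p.397 (quantifier template)] -/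
theorem ne2PlusOperator_fullG_C2_of_slim (hL : Odd L ∧ 1 < L) {b γ : ℝ} (hγ1 : γ ≤ 1) {c35 : ℝ} (hc35 : 0 ≤ c35)
    (h : NE2PlusOperator ((2 * (d : ℝ) + 3) * c35) (fgInstanceSlim d hL γ) (fgFamilySlim d hL b γ)) :
    NE2PlusOperator c35 (fgInstanceC2 d hL) (fgFamilyC2 d hL b) := by
  obtain ⟨M₅, δ₀, a₀, B₀, γ', hM₅, hδ₀, ha₀, hB₀, hγ', H⟩ := h
  refine ⟨M₅, δ₀, a₀, B₀, γ', hM₅, hδ₀, ha₀, hB₀, hγ', fun i hM α₀ hα₀ hMa U hU => ?_⟩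
  have hMpos : 0 < (fgInstanceC2 d hL i).gf.M := hM₅.trans_le hM
  have hc : 0 ≤ c35 * (unitTorusGeo L i.1.k (TGIndex.Mn d hL i.1)).M * α₀ := mul_nonneg (mul_nonneg hc35 hMpos.le) hα₀.le
  exact H i hM α₀ hα₀ hMa U (reg_slim_of_C2 hL hγ1 i hc U hU)

/-- ★★★ **`T4EtaRate.NE2PlusOperator` BY NAME, NO DISPLAYED BINDER, over the PRIMITIVE (3.35)–(3.36) carrier**: Bałaban's FULL `U ≡ 1` Landau-gauge propagator on
the torus family of record dressed by a live first-order scalar background whose regularity is ONLY the sup letters `|U|, |∇′U|, |∇′∇′U| ≤ c₃₅Mα₀` (field, first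
quotients, second quotients of `a′_μ`), all four (3.42) entries constructed, entry 2 by parts, `d ≥ 1`, odd `L ≥ 3`, `b > 0`, `c₃₅ > 0`; the rate exponent
(`1∕(8(d+1))`) is PRODUCED inside the `∃`, not supplied.  FILE 9 at `(2d+3)c₃₅` through the transfer.  MODEL-LEVEL species (abelianised `V′₁`, block-averaged coarse
partner), GENUINE propagator. [cite: Balaban1985BackgroundPropagators, Thm 3.1 p.397 (quantifier template); (3.35)–(3.36) p.396, (3.42) p.397 (shapes)] -/
theorem ne2PlusOperator_fullG_C2 (hd1 : 1 ≤ d) (hLodd : Odd L) (hL2 : 2 ≤ L) (hL : Odd L ∧ 1 < L) {b : ℝ} (hb : 0 < b) (c35 : ℝ) (hc35 : 0 < c35) :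
    NE2PlusOperator c35 (fgInstanceC2 d hL) (fgFamilyC2 d hL b) := by
  have hγ1 : 1 / (8 * ((d : ℝ) + 1)) ≤ 1 := by
    rw [div_le_one (by positivity)]
    have : (0 : ℝ) ≤ d := Nat.cast_nonneg d
    linarith
  have hd0 : (0 : ℝ) ≤ d := Nat.cast_nonneg d
  exact ne2PlusOperator_fullG_C2_of_slim d hL hγ1 hc35.le (ne2PlusOperator_fullG_slim d hd1 hLodd hL2 hL hb ((2 * (d : ℝ) + 3) * c35) (by positivity))

/-- The four-dimensional instance (`d + 1 = 4`). [cite: Balaban1985BackgroundPropagators, Thm 3.1 p.397 (quantifier template)] -/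
theorem ne2PlusOperator_fullG_C2_dim4 (hLodd : Odd L) (hL2 : 2 ≤ L) (hL : Odd L ∧ 1 < L) {b : ℝ} (hb : 0 < b) (c35 : ℝ) (hc35 : 0 < c35) :
    NE2PlusOperator c35 (fgInstanceC2 3 hL) (fgFamilyC2 3 hL b) :=
  ne2PlusOperator_fullG_C2 3 (by norm_num) hLodd hL2 hL hb c35 hc35

end Transfer

end Summit.QuantumFields.YangMills.BalabanUVNodes.N15.BackgroundLayer

end
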